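import Mathlib
import HarnessLib
import Summits.CriticalPhenomena.PercolationContinuityZ3.Theorems.PercNearOneGluingNoHeavyLowerTailKnQuestion8AntitheticProduct
import Summits.CriticalPhenomena.PercolationContinuityZ3.Theorems.PercNearOneGluingNoHeavyLowerTailKnQuestion8AntitheticLevelCube

/-!
# `NoHeavyLowerTail` (crux stmt-CriticalPhenomena-4575), antithetic vdBHK programme: AK-ORBIT COLUMNS for uniform certificates

Support file (seat `prim-ineq-gen-7` gen 41; `--supports stmt-CriticalPhenomena-4575`).  Nothing is asserted about the crux; no `sorry`,
no definitions.  Memo: run/shared/lean/prim/prim-ineq-gen-7/FINDING-AKORB-g41.md §1 (THEOREM AK-ORBIT).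

CONTEXT.  THEOREM LEVEL∞ (gen 40, `AntitheticLevelCube`, `AntitheticLevelPair`) proves an 'all `s`' level lemma on the Boolean lattice
`2^α` from a finite PAIR LEMMA whose right-hand side is a sum of KLEITMAN COLUMNS `Σ_y (u y − u yᶜ)(d yᶜ − d y) ≥ 0`
(`AntitheticLevelCube.kleitman_column`: Harris' inequality on `2^α` only).  For rests / fibres with a thick leg (positions `O × 2^α`,
`O` a finite poset with an antitone involution `j`, e.g. the bowtie `F_v(P₂)`), gen 40 showed that such columns do NOT suffice
(LP infeasibility, memo FINDING-LEVINF-g40 §5(b)).  THEOREM AK-ORBIT (memo FINDING-AKORB-g41 §1) enlarges the column family by the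
ANTIPODAL-KLEITMAN inequality of the product structure `O × 2^α`:
  `K_O := Σ_{(r,y) ∈ O × 2^α} [u (r,y)] · ([d (j r, yᶜ)] − [d (r,y)]) ≥ 0`   for `u` increasing and `d` decreasing on `O × 2^α`,
whenever `(O, ≤, j)` is an antipodal-Kleitman structure (`Σ_p f p (g p − g (j p)) ≥ 0` for monotone `f, g`) — by the product theorem
`AntitheticProduct.antipodalKleitman_prod` (gen 17) with the cube `AntitheticProduct.antipodalKleitman_cube`.  The orbits used by the
certificates of the memo (chains `{p < ιp}`, the bowtie, the fork poset `K_{4,4}`, their products) are AK by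
`AntitheticProduct.antipodalKleitman_of_comparable` (every element comparable with its partner) and `antipodalKleitman_prod`.
* `AntitheticOrbitColumn.orbit_column` — the inequality `K_O ≥ 0` (real form) from an AK hypothesis on `O`;
* `AntitheticOrbitColumn.orbit_column_int` — the same in `ℤ` (the form in which pair lemmas are assembled, cf. `AntitheticLevelCube.sum_nonneg_of_pair`);
* `AntitheticOrbitColumn.orbit_column_of_comparable` — `K_O ≥ 0` when every element of `O` is comparable with its `j`-partner.
-/

namespace Summit.CriticalPhenomena.PercolationContinuityZ3.Theorems

open Finset

namespace AntitheticOrbitColumn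

variable {O : Type*} [Fintype O] [Preorder O] {α : Type*} [Fintype α] [DecidableEq α]

/-- **ORBIT COLUMN (THEOREM AK-ORBIT, real form).**  If `(O, ≤, j)` is antipodal-Kleitman (`Σ_p f p (g p − g (j p)) ≥ 0` for all
monotone `f g : O → ℝ`), `u` is increasing and `d` is decreasing on `O × 2^α` (product order), then
`0 ≤ Σ_{(r,y)} [u (r,y)] · ([d (j r, yᶜ)] − [d (r,y)])`.  Proof: the product theorem with the cube, applied to `f = [u]` and the
monotone `g = 1 − [d]`. [this work; memo §1] -/
theorem orbit_column (j : O → O)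
    (hO : ∀ f g : O → ℝ, Monotone f → Monotone g → 0 ≤ ∑ p, f p * (g p - g (j p)))
    (u d : O × Finset α → Prop) [DecidablePred u] [DecidablePred d]
    (hu : ∀ z z' : O × Finset α, z ≤ z' → u z → u z') (hd : ∀ z z' : O × Finset α, z ≤ z' → d z' → d z) :
    0 ≤ ∑ z : O × Finset α, (if u z then (1:ℝ) else 0) * ((if d (j z.1, z.2ᶜ) then (1:ℝ) else 0) - (if d z then (1:ℝ) else 0)) := by
  -- the two monotone functions
  set f : O × Finset α → ℝ := fun z => if u z then 1 else 0 with hf_def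
  set g : O × Finset α → ℝ := fun z => 1 - (if d z then 1 else 0) with hg_def
  have hf : Monotone f := by
    intro z z' hzz
    simp only [hf_def]
    by_cases h : u z
    · have h' : u z' := hu z z' hzz h
      simp [h, h']
    · by_cases h' : u z' <;> simp [h, h']
  have hg : Monotone g := by
    intro z z' hzz
    simp only [hg_def]
    by_cases h' : d z'
    · have h : d z := hd z z' hzz h'
      simp [h, h']
    · by_cases h : d z <;> simp [h, h']
  have h₁ : ∀ f g : O → ℝ, Monotone f → Monotone g → 0 ≤ ∑ p, (fun _ => (1:ℝ)) p * (f p * (g p - g (j p))) := by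
    intro f g hf hg; simpa using hO f g hf hg
  have h₂ : ∀ f g : Finset α → ℝ, Monotone f → Monotone g → 0 ≤ ∑ q, (fun _ => (1:ℝ)) q * (f q * (g q - g qᶜ)) := by
    intro f g hf hg; simpa using AntitheticProduct.antipodalKleitman_cube f g hf hg
  have hprod := AntitheticProduct.antipodalKleitman_prod (fun _ : O => (1:ℝ)) (fun _ : Finset α => (1:ℝ))
    (fun _ => zero_le_one) (fun _ => zero_le_one) j (fun q : Finset α => qᶜ) h₁ h₂ f g hf hg
  have key : ∀ z : O × Finset α, (1:ℝ) * 1 * (f z * (g z - g (j z.1, z.2ᶜ))) =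
      (if u z then (1:ℝ) else 0) * ((if d (j z.1, z.2ᶜ) then (1:ℝ) else 0) - (if d z then (1:ℝ) else 0)) := by
    intro z; simp only [hf_def, hg_def]; ring
  have e : (∑ z : O × Finset α, (if u z then (1:ℝ) else 0) * ((if d (j z.1, z.2ᶜ) then (1:ℝ) else 0) - (if d z then (1:ℝ) else 0)))
      = ∑ z : O × Finset α, (1:ℝ) * 1 * (f z * (g z - g (j z.1, z.2ᶜ))) :=
    Finset.sum_congr rfl (fun z _ => (key z).symm)
  rw [e]; exact hprod

/-- **ORBIT COLUMN, integer form.**  As `orbit_column`, with the indicators valued in `ℤ`. [this work; memo §1] -/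
theorem orbit_column_int (j : O → O)
    (hO : ∀ f g : O → ℝ, Monotone f → Monotone g → 0 ≤ ∑ p, f p * (g p - g (j p)))
    (u d : O × Finset α → Prop) [DecidablePred u] [DecidablePred d]
    (hu : ∀ z z' : O × Finset α, z ≤ z' → u z → u z') (hd : ∀ z z' : O × Finset α, z ≤ z' → d z' → d z) :
    0 ≤ ∑ z : O × Finset α, (if u z then (1:ℤ) else 0) * ((if d (j z.1, z.2ᶜ) then (1:ℤ) else 0) - (if d z then (1:ℤ) else 0)) := by
  have h := orbit_column j hO u d hu hd
  have cast : ((∑ z : O × Finset α, (if u z then (1:ℤ) else 0) * ((if d (j z.1, z.2ᶜ) then (1:ℤ) else 0) - (if d z then (1:ℤ) else 0)) : ℤ) : ℝ)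
      = ∑ z : O × Finset α, (if u z then (1:ℝ) else 0) * ((if d (j z.1, z.2ᶜ) then (1:ℝ) else 0) - (if d z then (1:ℝ) else 0)) := by
    push_cast
    refine Finset.sum_congr rfl (fun z _ => ?_)
    by_cases h1 : u z <;> by_cases h2 : d (j z.1, z.2ᶜ) <;> by_cases h3 : d z <;> simp [h1, h2, h3]
  exact_mod_cast (cast ▸ h : (0:ℝ) ≤ _)

/-- **ORBIT COLUMN for comparable partners.**  If `j` is an involution of `O` reversing nothing but pairing every element with a
COMPARABLE partner (`r ≤ j r ∨ j r ≤ r`; e.g. the chains `{p < ιp}`, the bowtie `F_v(P₂)`, the fork poset), then `(O, ≤, j)` is AK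
(`AntitheticProduct.antipodalKleitman_of_comparable`) and the orbit column inequality holds. [this work; memo §1] -/
theorem orbit_column_of_comparable (j : O ≃ O) (hj : ∀ r, j (j r) = r) (hcomp : ∀ r, r ≤ j r ∨ j r ≤ r)
    (u d : O × Finset α → Prop) [DecidablePred u] [DecidablePred d]
    (hu : ∀ z z' : O × Finset α, z ≤ z' → u z → u z') (hd : ∀ z z' : O × Finset α, z ≤ z' → d z' → d z) :
    0 ≤ ∑ z : O × Finset α, (if u z then (1:ℤ) else 0) * ((if d (j z.1, z.2ᶜ) then (1:ℤ) else 0) - (if d z then (1:ℤ) else 0)) := by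
  have hO : ∀ f g : O → ℝ, Monotone f → Monotone g → 0 ≤ ∑ p, f p * (g p - g (j p)) := by
    intro f g hf hg
    have h := AntitheticProduct.antipodalKleitman_of_comparable (fun _ : O => (1:ℝ)) (fun _ => zero_le_one) j hj (fun _ => rfl) hcomp f g hf hg
    simpa using h
  exact orbit_column_int j hO u d hu hd

end AntitheticOrbitColumn

end Summit.CriticalPhenomena.PercolationContinuityZ3.Theorems
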